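import Mathlib
import Summits.Ventures.PercRepro2.TypedRow
import Summits.Ventures.PercRepro2.DoublyTypedRowGen
import Summits.Ventures.PercRepro2.SwOutJunctionsAsym
import Summits.Ventures.PercRepro2.SwAllLMarkThm

/-!
# The typed rows of record on the lane's graph classes (blind cell PercRepro2, night-4 g30,
2026-08-28; proofs/NIGHT4-G30.md §9)

The «asymmetric side» `tgtU2 ends l h 𝓤₁ 𝓤₂` of this seat's SwOutArmAsym IS the typed class
`typedQ ends l h 𝓤₁ 𝓤₂ᶜ` of night-4 g6's TYPED RIGID ROW (`TypedSwAll`, TypedRow.lean), and the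
«negative-mark side» `negSide ends l h p` of SwOutArmNegMark is the doubly typed class
`gTypedQ ends l h univ univ {S ∣ p ∉ S} ∅ univ` of night-4 g7 (`GTypedSwAll`,
DoublyTypedRowGen.lean).  This file is the bridge: `tgtU2_eq_typedQ`, `negSide_eq_gTypedQ`,
`typedSwAll_iff_swAll2`, `gTypedSwAll_of_swAllNeg`, and the kernel theorems of the rows of record
they yield — **`typedSwAll_of_outEdges`** (g10's class), **`typedSwAll_of_neverCoreF`** /
**`typedSwAll_of_bridges`** (g28's classes), **`typedSwAll_of_junction`** /
**`typedSwAll_of_junctions`** (g11's classes), for every up-set `𝓤` and down-set `𝓓`, and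
**`gTypedSwAll_neg_of_outEdges`** for the negative-mark instance of the doubly typed row.
-/

namespace Summit.Ventures.PercRepro2

namespace LocRows

open Hull

variable {V : Type*} {E : Type*} [Fintype E] [DecidableEq E]

open scoped Classical

variable {ends : E → Sym2 V} {l h p : V} {𝓤 𝓓 : Set (Set V)}

/-- The asymmetric side is the typed class at the complementary down-set. -/
lemma tgtU2_eq_typedQ : tgtU2 ends l h 𝓤 𝓓ᶜ = typedQ ends l h 𝓤 𝓓 := by
  ext ζ
  rw [mem_tgtU2]
  simp only [typedQ, Finset.mem_filter, Finset.mem_univ, true_and, Set.mem_compl_iff, not_not]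

/-- The typed class is the asymmetric side at the complementary up-set. -/
lemma typedQ_eq_tgtU2 : typedQ ends l h 𝓤 𝓓 = tgtU2 ends l h 𝓤 𝓓ᶜ := by
  rw [tgtU2_eq_typedQ]

/-- The negative-mark side is the doubly typed class with `𝓓″ = {S ∣ p ∉ S}` and everything else
trivial. -/
lemma negSide_eq_gTypedQ :
    negSide ends l h p = gTypedQ ends l h Set.univ Set.univ {S : Set V | p ∉ S} ∅ Set.univ := by
  ext ζ
  rw [mem_negSide]
  simp only [gTypedQ, Finset.mem_filter, Finset.mem_univ, true_and, Set.mem_setOf_eq,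
    Set.mem_univ, and_true, Set.mem_empty_iff_false, IsEmpty.forall_iff, implies_true]

omit [Fintype E] [DecidableEq E] in
/-- A rigid injection statement transports along an equality of the underlying finsets. -/
private lemma rigid_transport {Q Q' : Finset (Config E)} (hQ : Q = Q')
    (hs : ∃ f : {ζ // ζ ∈ Q} → Config E, Function.Injective f ∧
      ∀ x, f x ∈ Q ∧ ∀ e, e ∈ within ends (cluster ends x.1 h) → x.1 e = true → f x e = false) :
    ∃ f : {ζ // ζ ∈ Q'} → Config E, Function.Injective f ∧
      ∀ x, f x ∈ Q' ∧ ∀ e, e ∈ within ends (cluster ends x.1 h) → x.1 e = true → f x e = false := by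
  subst hQ
  exact hs

/-- **The typed rigid row is the asymmetric domination at the complementary up-set.** -/
theorem typedSwAll_iff_swAll2 : TypedSwAll ends l h 𝓤 𝓓 ↔ SwAll2 ends l h 𝓤 𝓓ᶜ :=
  ⟨fun hs => rigid_transport typedQ_eq_tgtU2 hs,
    fun hs => rigid_transport tgtU2_eq_typedQ hs⟩

/-- **The negative-mark domination is the doubly typed row at `𝓓″ = {S ∣ p ∉ S}`.** -/
theorem gTypedSwAll_iff_swAllNeg :
    GTypedSwAll ends l h Set.univ Set.univ {S : Set V | p ∉ S} ∅ Set.univ ↔ SwAllNeg ends l h p :=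
  ⟨fun hs => rigid_transport negSide_eq_gTypedQ.symm hs,
    fun hs => rigid_transport negSide_eq_gTypedQ hs⟩

/-- A down-set's complement is an up-set. -/
lemma isUpperSet_compl_of_isLowerSet (h𝓓 : IsLowerSet 𝓓) : IsUpperSet 𝓓ᶜ :=
  h𝓓.compl

/-- **The typed row on g10's class**: every vertex other than `l, h` forced by `𝓤`, joined to `l`,
or isolated (no loop at `h`), for every up-set `𝓤` and down-set `𝓓`. -/
theorem typedSwAll_of_outEdges (hlh : l ≠ h) (hloop : ∀ e, ends e ≠ s(h, h))
    (h𝓤 : IsUpperSet 𝓤) (h𝓓 : IsLowerSet 𝓓)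
    (hout : ∀ x, x ≠ l → x ≠ h →
      (∀ S ∈ 𝓤, x ∈ S) ∨ (∃ e, ends e = s(x, l)) ∨ (∀ e, x ∉ ends e)) :
    TypedSwAll ends l h 𝓤 𝓓 :=
  typedSwAll_iff_swAll2.2 (swAll2_of_outEdges hlh hloop h𝓤 h𝓓.compl hout)

/-- **The typed row on g28's never-core class.** -/
theorem typedSwAll_of_neverCoreF {F : V → Prop} (hlh : l ≠ h) (hloop : ∀ e, ends e ≠ s(h, h))
    (h𝓤 : IsUpperSet 𝓤) (h𝓓 : IsLowerSet 𝓓) (hF : ∀ x, F x → ∀ S ∈ 𝓤, x ∈ S)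
    (hN : ∀ x, x ≠ l → x ≠ h → NeverCoreF ends ({l}ᶜ) h F x) : TypedSwAll ends l h 𝓤 𝓓 :=
  typedSwAll_iff_swAll2.2 (swAll2_of_neverCoreF hlh hloop h𝓤 h𝓓.compl hF hN)

/-- **The typed row on g28's bridge class.** -/
theorem typedSwAll_of_bridges (hlh : l ≠ h) (hloop : ∀ e, ends e ≠ s(h, h))
    (h𝓤 : IsUpperSet 𝓤) (h𝓓 : IsLowerSet 𝓓)
    (hbr : ∀ x, x ≠ l → x ≠ h → (∀ S ∈ 𝓤, x ∈ S) ∨ (∃ e, ends e = s(x, l)) ∨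
      (∀ e, x ∉ ends e) ∨ ∃ e₀, x ∉ cluster ends (cutConfig ends ({l}ᶜ) e₀) h) :
    TypedSwAll ends l h 𝓤 𝓓 :=
  typedSwAll_iff_swAll2.2 (swAll2_of_bridges hlh hloop h𝓤 h𝓓.compl hbr)

/-- **The typed row on g11's one-junction class.** -/
theorem typedSwAll_of_junction {F : V → Prop} {u : V} (hlh : l ≠ h) (hlu : l ≠ u) (hhu : h ≠ u)
    (hloop_h : ∀ e, ends e ≠ s(h, h)) (hloop_u : ∀ e, ends e ≠ s(u, u))
    (h𝓤 : IsUpperSet 𝓤) (h𝓓 : IsLowerSet 𝓓) (hF : ∀ x, F x → ∀ S ∈ 𝓤, x ∈ S)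
    (hadj : ∀ e (he : u ∈ ends e), Sym2.Mem.other he ≠ h →
      ∃ e', ends e' = s(Sym2.Mem.other he, h))
    (hout : ∀ x, x ≠ l → x ≠ h → x ≠ u →
      F x ∨ (∃ e, ends e = s(x, l)) ∨ (∀ e, x ∉ ends e)) :
    TypedSwAll ends l h 𝓤 𝓓 :=
  typedSwAll_iff_swAll2.2
    (swAll2_of_junction hlh hlu hhu hloop_h hloop_u h𝓤 h𝓓.compl hF hadj hout)

/-- **The typed row on g11's independent-junction class.** -/
theorem typedSwAll_of_junctions {F : V → Prop} {J : Set V} (hlh : l ≠ h)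
    (hloop_h : ∀ e, ends e ≠ s(h, h)) (hlJ : l ∉ J) (hhJ : h ∉ J) (hind : IndepSet ends J)
    (h𝓤 : IsUpperSet 𝓤) (h𝓓 : IsLowerSet 𝓓) (hF : ∀ x, F x → ∀ S ∈ 𝓤, x ∈ S)
    (hadj : ∀ u ∈ J, ∀ e (he : u ∈ ends e), Sym2.Mem.other he ≠ h →
      ∃ e', ends e' = s(Sym2.Mem.other he, h))
    (hout : ∀ x, x ≠ l → x ≠ h → x ∉ J →
      F x ∨ (∃ e, ends e = s(x, l)) ∨ (∀ e, x ∉ ends e)) :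
    TypedSwAll ends l h 𝓤 𝓓 :=
  typedSwAll_iff_swAll2.2
    (swAll2_of_junctions hlh hloop_h hlJ hhJ hind h𝓤 h𝓓.compl hF hadj hout)

/-- **The negative-mark instance of the doubly typed row on g10's class**: every vertex other than
`l, h, p` joined to `l` or in no red cluster of `h` at all (no loop at `h`). -/
theorem gTypedSwAll_neg_of_outEdges (hlh : l ≠ h) (hloop : ∀ e, ends e ≠ s(h, h))
    (hout : ∀ y, y ≠ l → y ≠ h → y ≠ p →
      (∃ e, ends e = s(y, l)) ∨ (∀ ζ : Config E, y ∉ cluster ends ζ h)) :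
    GTypedSwAll ends l h Set.univ Set.univ {S : Set V | p ∉ S} ∅ Set.univ :=
  gTypedSwAll_iff_swAllNeg.2 (swAllNeg_of_outEdges' hlh hloop hout)

/-- **The L-mark step read on the rows of record**: row 2′SW-ALL with the mark at `x` (one edge to
`p`, edges to `l`) from the doubly typed row at `𝓓″ = {S ∣ p ∉ S}` and the typed row at the
principal pair, both on the isolated graph. -/
theorem IsLMarkAt.swAll_lMark_of_typed {x : V} {e₀ : E} (hm : IsLMarkAt ends x p l e₀)
    (hxh : x ≠ h)
    (hneg : GTypedSwAll (isolate ends x) l h Set.univ Set.univ {S : Set V | p ∉ S} ∅ Set.univ)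
    (hp : TypedSwAll (isolate ends x) l h {S : Set V | p ∈ S} {S : Set V | p ∉ S}) :
    SwAll ends l h x :=
  hm.swAll_lMark hxh (gTypedSwAll_iff_swAllNeg.1 hneg) (swAll_of_typed _ hp)

end LocRows

end Summit.Ventures.PercRepro2
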